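import Mathlib
import Summits.Ventures.FusionMHD.Models.CerfonFreidbergIterLikeQHalfLink
import HarnessLib

/-!
# Ventures/FusionMHD — Models/CerfonFreidbergIterLikeQHalfPanel.lean: the PER-PANEL LINK THEOREM `panel_bracket` — from the kernel
# certificates of one `θ`-panel to the bracket of the polar `(6.35)` integral of the TRUE surface `ψ_N = 1/2` over that panel

HONEST FRAMING (LADDER-GRIDFUSION three columns; CF rung, F2 item R2).  Sequel of `Models/CerfonFreidbergIterLikeQHalfLink.lean` (objects,
`LinkData.check`, the envelope algebra).  For a panel `j` whose certificate `d : PanelCert` (`…QHalfPanels*.lean`), box data `b : BoxData`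
(`…QHalfBoxesA/B.lean`) and link constants `ℓ : LinkData` pass `d.ok`, `b.ok`, `ℓ.check d b` (all `decide`d in the assembly file), on
`Θ_j = [π·2jh, π·(2j+2)h]`: the ray profile of THE CF ITER-like flux is strictly increasing on the strip `[s_A, s_max]`, below the level on the
core, so the surface `U = U(X_a,0)/2` is met exactly once on every ray — at the glued radius `ρ(θ)` (model-7's `rayRadius`), inside the tube
`|ρ − m| < r_j` around the certified approximant, `ρ` continuous, `D_r(θ, ρ) > 0` — and
**`Lo_j ≤ ∫_{Θ_j} ρ/((X_a + ρ cos θ)·D_r(θ, ρ)) dθ ≤ Hi_j`** (model-7's `panel_integral_envelope` with the relative envelope, the kernel's integral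
segment moved to `θ` by the change of variables `θ = π t`).  MODELLED: analytic Cerfon–Freidberg family; `q` of a MODEL surface — nothing about
a device or stability.  No `decide`; `maxHeartbeats` raised for the one long proof.  Typer/prover: gridfusion-model-5 (g7), 2026-08-27.
Citations: Freidberg 2014 §6.3.5 (6.35) [Freidberg2014].
-/

noncomputable section

open Set MeasureTheory intervalIntegral
open Literature.Analysis.ValidatedNumerics Literature.Analysis.ValidatedNumerics.PolyMP
open Literature.Analysis.ValidatedNumerics.NumericsMP Literature.Analysis.ValidatedNumerics.ExpPoly
open Literature.MathematicalPhysics.MHD Literature.MathematicalPhysics.MHD.CerfonFreidberg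
open Summit.Ventures.FusionMHD.Models.PolarRay

namespace Summit.Ventures.FusionMHD.Models.CFIterLike.QHalf

/-! ## §4 The per-panel link theorem -/

section panel

variable {d : PanelCert} {b : BoxData} {ℓ : LinkData}

/-- `X = X_a + s cos θ > 0` for `0 ≤ s < 1`. -/
theorem X_pos {θ s : ℝ} (h0 : 0 ≤ s) (h1 : s < 1) : 0 < Xa + s * Real.cos θ :=
  X_pos_of_box h0 h1 ⟨le_rfl, le_rfl⟩

set_option maxHeartbeats 4000000 in
/-- **THE PER-PANEL LINK.**  See the module docstring. -/
theorem panel_bracket (hd : d.ok = true) (hb : b.ok = true) (hℓ : ℓ.check d b = true) :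
    ((ℓ.Lo : ℚ) : ℝ) ≤ ∫ θ in (Real.pi * ((panelLeft hw d.j : ℚ) : ℝ))..(Real.pi * ((panelLeft hw (d.j + 1) : ℚ) : ℝ)),
        polarIntegrand U Xa 0 u₀ Dfield θ
    ∧ ∫ θ in (Real.pi * ((panelLeft hw d.j : ℚ) : ℝ))..(Real.pi * ((panelLeft hw (d.j + 1) : ℚ) : ℝ)),
        polarIntegrand U Xa 0 u₀ Dfield θ ≤ ((ℓ.Hi : ℚ) : ℝ)
    ∧ IntervalIntegrable (polarIntegrand U Xa 0 u₀ Dfield) volume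
        (Real.pi * ((panelLeft hw d.j : ℚ) : ℝ)) (Real.pi * ((panelLeft hw (d.j + 1) : ℚ) : ℝ))
    ∧ ContinuousOn ρ (Icc (Real.pi * ((panelLeft hw d.j : ℚ) : ℝ)) (Real.pi * ((panelLeft hw (d.j + 1) : ℚ) : ℝ)))
    ∧ (∀ θ ∈ Icc (Real.pi * ((panelLeft hw d.j : ℚ) : ℝ)) (Real.pi * ((panelLeft hw (d.j + 1) : ℚ) : ℝ)),
        rayProfile U Xa 0 θ (ρ θ) = u₀ ∧ |ρ θ - mθ θ| < ((ℓ.r : ℚ) : ℝ) ∧ 0 < ρ θ ∧ ρ θ < 1 ∧ 0 < Dfield θ (ρ θ)) := by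
  set a : ℝ := Real.pi * ((panelLeft hw d.j : ℚ) : ℝ) with ha_def
  set a' : ℝ := Real.pi * ((panelLeft hw (d.j + 1) : ℚ) : ℝ) with ha'_def
  -- unpack the rational side conditions
  simp only [LinkData.check, Bool.and_eq_true, decide_eq_true_eq] at hℓ
  obtain ⟨⟨⟨⟨⟨⟨⟨⟨⟨⟨⟨⟨⟨⟨⟨⟨⟨⟨⟨⟨⟨⟨⟨⟨⟨cbj, cℓj⟩, cthlo⟩, cthhi⟩, csA0⟩, csA⟩, csmax⟩, cr0⟩, crμ⟩, clam0⟩, clam1⟩, clam2⟩, cdtop1⟩, cdtop2⟩, cM0⟩, cmlo0⟩, cdlo0⟩, cplo0⟩, ckap⟩, ceps⟩, ceps1⟩, crX⟩, crD⟩, ckplus⟩, cLo⟩, cHi⟩ := hℓ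
  -- the kernel facts
  obtain ⟨hseg, hres, hm, hD⟩ := sound_of_ok hd
  obtain ⟨hB1, hB2⟩ := BoxData.sound hb
  have hbok := hb
  simp only [BoxData.ok, Bool.and_eq_true, decide_eq_true_eq] at hbok
  obtain ⟨⟨⟨⟨⟨⟨⟨⟨⟨-, -⟩, -⟩, -⟩, -⟩, -⟩, hsAsmax⟩, hsmax1⟩, -⟩, -⟩ := hbok
  -- real versions of the constants
  have hS : (0 : ℝ) < ((tmS : ℕ) : ℝ) := by exact_mod_cast tmS_pos
  have hpi := Real.pi_pos
  have hpiLo : ((piLoQ : ℚ) : ℝ) < Real.pi := by have := Real.pi_gt_d20; norm_num [piLoQ] at this ⊢; exact this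
  have hpiHi : Real.pi < ((piHiQ : ℚ) : ℝ) := by have := Real.pi_lt_d20; norm_num [piHiQ] at this ⊢; exact this
  -- θ ∈ [a, a'] ↦ t = θ/π ∈ panel j, and θ ∈ [thlo, thhi]
  have hpl0 : (0 : ℚ) ≤ panelLeft hw d.j := by unfold panelLeft hw; positivity
  have haa' : a ≤ a' := by
    apply mul_le_mul_of_nonneg_left _ hpi.le
    exact_mod_cast (show panelLeft hw d.j ≤ panelLeft hw (d.j + 1) by unfold panelLeft hw; push_cast; nlinarith)
  have hθbox : ∀ θ ∈ Icc a a', θ ∈ Icc ((b.thlo : ℚ) : ℝ) ((b.thhi : ℚ) : ℝ) := by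
    intro θ hθ
    have h1 : ((b.thlo : ℚ) : ℝ) ≤ a := by
      have : ((b.thlo : ℚ) : ℝ) ≤ ((piLoQ : ℚ) : ℝ) * ((panelLeft hw d.j : ℚ) : ℝ) := by exact_mod_cast cthlo
      have h2 : ((piLoQ : ℚ) : ℝ) * ((panelLeft hw d.j : ℚ) : ℝ) ≤ a :=
        mul_le_mul_of_nonneg_right hpiLo.le (by exact_mod_cast hpl0)
      linarith
    have h2 : a' ≤ ((b.thhi : ℚ) : ℝ) := by
      have : ((piHiQ : ℚ) : ℝ) * ((panelLeft hw (d.j + 1) : ℚ) : ℝ) ≤ ((b.thhi : ℚ) : ℝ) := by exact_mod_cast cthhi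
      have hpl1 : (0 : ℝ) ≤ ((panelLeft hw (d.j + 1) : ℚ) : ℝ) := by
        exact_mod_cast (show (0 : ℚ) ≤ panelLeft hw (d.j + 1) by unfold panelLeft hw; positivity)
      have h3 : a' ≤ ((piHiQ : ℚ) : ℝ) * ((panelLeft hw (d.j + 1) : ℚ) : ℝ) := mul_le_mul_of_nonneg_right hpiHi.le hpl1
      linarith
    exact ⟨h1.trans hθ.1, hθ.2.trans h2⟩
  have hθt : ∀ θ ∈ Icc a a', |θ / Real.pi - ((ctr d.j : ℚ) : ℝ)| ≤ ((hw : ℚ) : ℝ) := by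
    intro θ hθ
    have e1 : ((ctr d.j : ℚ) : ℝ) = ((panelLeft hw d.j : ℚ) : ℝ) + ((hw : ℚ) : ℝ) := by
      simp only [ctr, panelLeft]; push_cast; ring
    have e2 : ((panelLeft hw (d.j + 1) : ℚ) : ℝ) = ((panelLeft hw d.j : ℚ) : ℝ) + 2 * ((hw : ℚ) : ℝ) := by
      simp only [panelLeft]; push_cast; ring
    have ht1 : ((panelLeft hw d.j : ℚ) : ℝ) ≤ θ / Real.pi := by
      rw [le_div_iff₀ hpi]; linarith [hθ.1, mul_comm Real.pi (((panelLeft hw d.j : ℚ) : ℝ))]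
    have ht2 : θ / Real.pi ≤ ((panelLeft hw (d.j + 1) : ℚ) : ℝ) := by
      rw [div_le_iff₀ hpi]; linarith [hθ.2, mul_comm Real.pi (((panelLeft hw (d.j + 1) : ℚ) : ℝ))]
    rw [e1, abs_le]; constructor <;> linarith
  -- per-θ facts from the panel certificate (t = θ/π = ctr j + u)
  have hθm : ∀ θ ∈ Icc a a', ((d.mlo : ℝ) / ((tmS : ℕ) : ℝ)) ≤ mθ θ ∧ mθ θ ≤ ((d.mhi : ℝ) / ((tmS : ℕ) : ℝ)) := by
    intro θ hθ
    have h := hm (θ / Real.pi - ((ctr d.j : ℚ) : ℝ)) (hθt θ hθ)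
    simp only [add_sub_cancel] at h
    exact h
  have hθres : ∀ θ ∈ Icc a a', |rayProfile U Xa 0 θ (mθ θ) - u₀| ≤ ((d.eta : ℝ) / ((tmS : ℕ) : ℝ)) := by
    intro θ hθ
    have h := hres (θ / Real.pi - ((ctr d.j : ℚ) : ℝ)) (hθt θ hθ)
    simp only [add_sub_cancel] at h
    have e : Real.pi * (θ / Real.pi) = θ := mul_div_cancel₀ θ hpi.ne'
    unfold resid at h
    rw [e] at h
    unfold rayProfile u₀ mθ
    rw [zero_add]
    exact h
  have hθD : ∀ θ ∈ Icc a a', ((d.dlo : ℝ) / ((tmS : ℕ) : ℝ)) ≤ Dfield θ (mθ θ) ∧ Dfield θ (mθ θ) ≤ ((d.dhi : ℝ) / ((tmS : ℕ) : ℝ)) := by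
    intro θ hθ
    have h := hD (θ / Real.pi - ((ctr d.j : ℚ) : ℝ)) (hθt θ hθ)
    simp only [add_sub_cancel] at h
    have e : Real.pi * (θ / Real.pi) = θ := mul_div_cancel₀ θ hpi.ne'
    unfold DrA at h
    rw [e] at h
    exact h
  -- constants in ℝ
  have hsA0 : 0 < ((b.sA : ℚ) : ℝ) := by exact_mod_cast csA0
  have hsAr : ((b.sA : ℚ) : ℝ) + ((ℓ.r : ℚ) : ℝ) ≤ ((d.mlo : ℝ) / ((tmS : ℕ) : ℝ)) := by
    have := (show ((b.sA + ℓ.r : ℚ) : ℝ) ≤ (((d.mlo : ℚ) / tmS : ℚ) : ℝ) by exact_mod_cast csA); push_cast at this; exact this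
  have hmhir : ((d.mhi : ℝ) / ((tmS : ℕ) : ℝ)) + ((ℓ.r : ℚ) : ℝ) ≤ ((b.smax : ℚ) : ℝ) := by
    have := (show ((((d.mhi : ℚ) / tmS + ℓ.r : ℚ)) : ℝ) ≤ ((b.smax : ℚ) : ℝ) by exact_mod_cast csmax); push_cast at this; exact this
  have hr0 : 0 < ((ℓ.r : ℚ) : ℝ) := by exact_mod_cast cr0
  have hrμ : ((d.eta : ℝ) / ((tmS : ℕ) : ℝ)) < ((ℓ.r : ℚ) : ℝ) * (((d.dlo : ℝ) / ((tmS : ℕ) : ℝ)) - ((b.M : ℚ) : ℝ) * ((ℓ.r : ℚ) : ℝ)) := by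
    have := (show ((((d.eta : ℚ) / tmS : ℚ)) : ℝ) < ((ℓ.r * ((d.dlo : ℚ) / tmS - b.M * ℓ.r) : ℚ) : ℝ) by exact_mod_cast crμ)
    push_cast at this; exact this
  have hlam0 : 0 < ((ℓ.lam : ℚ) : ℝ) := by exact_mod_cast clam0
  have hlam1 : ((ℓ.lam : ℚ) : ℝ) + ((b.M : ℚ) : ℝ) * (((d.mhi : ℝ) / ((tmS : ℕ) : ℝ)) - ((b.sA : ℚ) : ℝ)) ≤ ((d.dlo : ℝ) / ((tmS : ℕ) : ℝ)) := by
    have := (show ((ℓ.lam + b.M * ((d.mhi : ℚ) / tmS - b.sA) : ℚ) : ℝ) ≤ ((((d.dlo : ℚ) / tmS : ℚ)) : ℝ) by exact_mod_cast clam1)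
    push_cast at this; exact this
  have hlam2 : ((ℓ.lam : ℚ) : ℝ) + ((b.M : ℚ) : ℝ) * (((b.smax : ℚ) : ℝ) - ((d.mlo : ℝ) / ((tmS : ℕ) : ℝ))) ≤ ((d.dlo : ℝ) / ((tmS : ℕ) : ℝ)) := by
    have := (show ((ℓ.lam + b.M * (b.smax - (d.mlo : ℚ) / tmS) : ℚ) : ℝ) ≤ ((((d.dlo : ℚ) / tmS : ℚ)) : ℝ) by exact_mod_cast clam2)
    push_cast at this; exact this
  have hdtop1 : ((d.dhi : ℝ) / ((tmS : ℕ) : ℝ)) + ((b.M : ℚ) : ℝ) * (((d.mhi : ℝ) / ((tmS : ℕ) : ℝ)) - ((b.sA : ℚ) : ℝ)) ≤ ((ℓ.dtop : ℚ) : ℝ) := by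
    have := (show ((((d.dhi : ℚ) / tmS + b.M * ((d.mhi : ℚ) / tmS - b.sA) : ℚ)) : ℝ) ≤ ((ℓ.dtop : ℚ) : ℝ) by exact_mod_cast cdtop1)
    push_cast at this; exact this
  have hdtop2 : ((d.dhi : ℝ) / ((tmS : ℕ) : ℝ)) + ((b.M : ℚ) : ℝ) * (((b.smax : ℚ) : ℝ) - ((d.mlo : ℝ) / ((tmS : ℕ) : ℝ))) ≤ ((ℓ.dtop : ℚ) : ℝ) := by
    have := (show ((((d.dhi : ℚ) / tmS + b.M * (b.smax - (d.mlo : ℚ) / tmS) : ℚ)) : ℝ) ≤ ((ℓ.dtop : ℚ) : ℝ) by exact_mod_cast cdtop2)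
    push_cast at this; exact this
  have hM0 : 0 ≤ ((b.M : ℚ) : ℝ) := by exact_mod_cast cM0
  have hmlo0 : 0 < ((d.mlo : ℝ) / ((tmS : ℕ) : ℝ)) := div_pos (by exact_mod_cast cmlo0) hS
  have hdlo0 : 0 < ((d.dlo : ℝ) / ((tmS : ℕ) : ℝ)) := div_pos (by exact_mod_cast cdlo0) hS
  have hsmax1 : ((b.smax : ℚ) : ℝ) < 1 := by exact_mod_cast hsmax1
  have hsAsmax' : ((b.sA : ℚ) : ℝ) ≤ ((b.smax : ℚ) : ℝ) := by exact_mod_cast hsAsmax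
  have hXaLo : ((XaLoQ : ℚ) : ℝ) ≤ Xa := by have := Xa_bounds.1; norm_num [XaLoQ] at this ⊢; exact this
  -- derivative facts on [0, ((b.smax : ℚ) : ℝ)] ⊂ [0, 1)
  have hderF : ∀ θ s, 0 ≤ s → s ≤ ((b.smax : ℚ) : ℝ) → HasDerivAt (rayProfile U Xa 0 θ) (Dfield θ s) s := by
    intro θ s h0 h1; exact hasDerivAt_rayProfile (X_pos h0 (h1.trans_lt hsmax1))
  have hderD : ∀ θ s, 0 ≤ s → s ≤ ((b.smax : ℚ) : ℝ) → HasDerivAt (fun x => Dfield θ x) (F2c coeff Xa s θ) s := by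
    intro θ s h0 h1; exact hasDerivAt_Drc (X_pos h0 (h1.trans_lt hsmax1))
  -- Lipschitz of D on the strip
  have hLip : ∀ θ ∈ Icc a a', ∀ s ∈ Icc ((b.sA : ℚ) : ℝ) ((b.smax : ℚ) : ℝ), ∀ s' ∈ Icc ((b.sA : ℚ) : ℝ) ((b.smax : ℚ) : ℝ), |Dfield θ s - Dfield θ s'| ≤ ((b.M : ℚ) : ℝ) * |s - s'| := by
    intro θ hθ s hs s' hs'
    have h := Convex.norm_image_sub_le_of_norm_hasDerivWithin_le (f := fun x => Dfield θ x) (f' := fun x => F2c coeff Xa x θ)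
      (s := Icc ((b.sA : ℚ) : ℝ) ((b.smax : ℚ) : ℝ)) (fun x hx => (hderD θ x (hsA0.le.trans hx.1) hx.2).hasDerivWithinAt)
      (fun x hx => by rw [Real.norm_eq_abs]; exact hB2 θ (hθbox θ hθ) x hx) (convex_Icc _ _) hs' hs
    rw [Real.norm_eq_abs, Real.norm_eq_abs] at h
    exact h
  -- D bounds on the strip: ((ℓ.lam : ℚ) : ℝ) ≤ D ≤ ((ℓ.dtop : ℚ) : ℝ) (via the certified value at m and the Lipschitz bound)
  have hmstrip : ∀ θ ∈ Icc a a', mθ θ ∈ Icc ((b.sA : ℚ) : ℝ) ((b.smax : ℚ) : ℝ) := by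
    intro θ hθ; obtain ⟨h1, h2⟩ := hθm θ hθ; exact ⟨by linarith, by linarith⟩
  have hDstrip : ∀ θ ∈ Icc a a', ∀ s ∈ Icc ((b.sA : ℚ) : ℝ) ((b.smax : ℚ) : ℝ), ((ℓ.lam : ℚ) : ℝ) ≤ Dfield θ s ∧ Dfield θ s ≤ ((ℓ.dtop : ℚ) : ℝ) := by
    intro θ hθ s hs
    have hL := hLip θ hθ s hs (mθ θ) (hmstrip θ hθ)
    obtain ⟨hm1, hm2⟩ := hθm θ hθ
    obtain ⟨hD1, hD2⟩ := hθD θ hθ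
    have hdist : |s - mθ θ| ≤ max (((d.mhi : ℝ) / ((tmS : ℕ) : ℝ)) - ((b.sA : ℚ) : ℝ)) (((b.smax : ℚ) : ℝ) - ((d.mlo : ℝ) / ((tmS : ℕ) : ℝ))) := by
      rw [abs_le]; constructor
      · have : ((b.sA : ℚ) : ℝ) - ((d.mhi : ℝ) / ((tmS : ℕ) : ℝ)) ≤ s - mθ θ := by linarith [hs.1]
        have : -(max (((d.mhi : ℝ) / ((tmS : ℕ) : ℝ)) - ((b.sA : ℚ) : ℝ)) (((b.smax : ℚ) : ℝ) - ((d.mlo : ℝ) / ((tmS : ℕ) : ℝ)))) ≤ ((b.sA : ℚ) : ℝ) - ((d.mhi : ℝ) / ((tmS : ℕ) : ℝ)) := by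
          have := le_max_left (((d.mhi : ℝ) / ((tmS : ℕ) : ℝ)) - ((b.sA : ℚ) : ℝ)) (((b.smax : ℚ) : ℝ) - ((d.mlo : ℝ) / ((tmS : ℕ) : ℝ))); linarith
        linarith
      · exact le_trans (by linarith [hs.2]) (le_max_right _ _)
    have hMd : ((b.M : ℚ) : ℝ) * |s - mθ θ| ≤ ((b.M : ℚ) : ℝ) * max (((d.mhi : ℝ) / ((tmS : ℕ) : ℝ)) - ((b.sA : ℚ) : ℝ)) (((b.smax : ℚ) : ℝ) - ((d.mlo : ℝ) / ((tmS : ℕ) : ℝ))) := mul_le_mul_of_nonneg_left hdist hM0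
    have hmax : ((b.M : ℚ) : ℝ) * max (((d.mhi : ℝ) / ((tmS : ℕ) : ℝ)) - ((b.sA : ℚ) : ℝ)) (((b.smax : ℚ) : ℝ) - ((d.mlo : ℝ) / ((tmS : ℕ) : ℝ))) ≤ ((d.dlo : ℝ) / ((tmS : ℕ) : ℝ)) - ((ℓ.lam : ℚ) : ℝ) ∧ ((b.M : ℚ) : ℝ) * max (((d.mhi : ℝ) / ((tmS : ℕ) : ℝ)) - ((b.sA : ℚ) : ℝ)) (((b.smax : ℚ) : ℝ) - ((d.mlo : ℝ) / ((tmS : ℕ) : ℝ))) ≤ ((ℓ.dtop : ℚ) : ℝ) - ((d.dhi : ℝ) / ((tmS : ℕ) : ℝ)) := by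
      rcases le_total (((d.mhi : ℝ) / ((tmS : ℕ) : ℝ)) - ((b.sA : ℚ) : ℝ)) (((b.smax : ℚ) : ℝ) - ((d.mlo : ℝ) / ((tmS : ℕ) : ℝ))) with h | h
      · rw [max_eq_right h]; constructor <;> linarith
      · rw [max_eq_left h]; constructor <;> linarith
    have hab := abs_le.1 (le_trans hL hMd)
    constructor <;> linarith [hmax.1, hmax.2]
  -- strict monotonicity of the ray profile on the strip, continuity
  have hcontF : ∀ θ, ContinuousOn (rayProfile U Xa 0 θ) (Icc ((b.sA : ℚ) : ℝ) ((b.smax : ℚ) : ℝ)) := by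
    intro θ s hs; exact (hderF θ s (hsA0.le.trans hs.1) hs.2).continuousAt.continuousWithinAt
  have hmono : ∀ θ ∈ Icc a a', StrictMonoOn (rayProfile U Xa 0 θ) (Icc ((b.sA : ℚ) : ℝ) ((b.smax : ℚ) : ℝ)) := by
    intro θ hθ
    apply strictMonoOn_rayProfile_of_deriv_pos (hcontF θ)
    intro s hs
    rw [(hderF θ s (hsA0.le.trans hs.1.le) hs.2.le).deriv]
    exact hlam0.trans_le (hDstrip θ hθ s ⟨hs.1.le, hs.2.le⟩).1
  -- the glue's coarse hypotheses
  have hkap : (0 : ℝ) < ((b.kap : ℚ) : ℝ) := by exact_mod_cast ckap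
  have hin : ∀ θ ∈ Icc a a', ∀ s, 0 < s → s ≤ ((b.sA : ℚ) : ℝ) → rayProfile U Xa 0 θ s < u₀ := by
    intro θ hθ s hs0 hs1
    have h := hB1 θ (hθbox θ hθ) s ⟨hs0.le, hs1⟩
    unfold u₀; linarith
  -- signs at the tube ends from residual + slope
  have htube_sub : ∀ θ ∈ Icc a a', ∀ s ∈ Icc (mθ θ - ((ℓ.r : ℚ) : ℝ)) (mθ θ + ((ℓ.r : ℚ) : ℝ)), s ∈ Icc ((b.sA : ℚ) : ℝ) ((b.smax : ℚ) : ℝ) := by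
    intro θ hθ s hs; obtain ⟨h1, h2⟩ := hθm θ hθ; exact ⟨by linarith [hs.1], by linarith [hs.2]⟩
  have hslope : ∀ θ ∈ Icc a a', ∀ s ∈ Icc (mθ θ - ((ℓ.r : ℚ) : ℝ)) (mθ θ + ((ℓ.r : ℚ) : ℝ)),
      HasDerivAt (rayProfile U Xa 0 θ) (Dfield θ s) s ∧ ((d.dlo : ℝ) / ((tmS : ℕ) : ℝ)) - ((b.M : ℚ) : ℝ) * ((ℓ.r : ℚ) : ℝ) ≤ Dfield θ s := by
    intro θ hθ s hs
    have hs' := htube_sub θ hθ s hs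
    refine ⟨hderF θ s (hsA0.le.trans hs'.1) hs'.2, ?_⟩
    have hL := hLip θ hθ s hs' (mθ θ) (hmstrip θ hθ)
    have hsm : |s - mθ θ| ≤ ((ℓ.r : ℚ) : ℝ) := abs_le.2 ⟨by linarith [hs.1], by linarith [hs.2]⟩
    have h1 := abs_le.1 (le_trans hL (mul_le_mul_of_nonneg_left hsm hM0))
    linarith [(hθD θ hθ).1]
  have hsign : ∀ θ ∈ Icc a a', rayProfile U Xa 0 θ (mθ θ - ((ℓ.r : ℚ) : ℝ)) < u₀ ∧ u₀ < rayProfile U Xa 0 θ (mθ θ + ((ℓ.r : ℚ) : ℝ)) := by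
    intro θ hθ
    exact signs_of_residual_of_slope (F := rayProfile U Xa 0 θ) (F' := Dfield θ) hr0 hrμ (hθres θ hθ)
      (fun s hs => (hslope θ hθ s hs).1) (fun s hs => (hslope θ hθ s hs).2)
  have hout : ∀ θ ∈ Icc a a', u₀ < rayProfile U Xa 0 θ ((b.smax : ℚ) : ℝ) := by
    intro θ hθ
    obtain ⟨h1, h2⟩ := hθm θ hθ
    have hle := (hmono θ hθ).monotoneOn ⟨by linarith, by linarith⟩ ⟨hsAsmax', le_rfl⟩
      (show mθ θ + ((ℓ.r : ℚ) : ℝ) ≤ ((b.smax : ℚ) : ℝ) by linarith)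
    exact (hsign θ hθ).2.trans_le hle
  -- joint continuity (Ray file)
  have hF : ContinuousOn (fun p : ℝ × ℝ => rayProfile U Xa 0 p.1 p.2) (Icc a a' ×ˢ Icc ((b.sA : ℚ) : ℝ) ((b.smax : ℚ) : ℝ)) :=
    continuousOn_rayProfile_box hsA0.le hsmax1
  have hDc : ContinuousOn (fun p : ℝ × ℝ => Dfield p.1 p.2) (Icc a a' ×ˢ Icc ((b.sA : ℚ) : ℝ) ((b.smax : ℚ) : ℝ)) :=
    continuousOn_Drc_box hsA0.le hsmax1
  -- X bounds
  have hRlo : 0 < Xa - ((b.smax : ℚ) : ℝ) := by linarith [Xa_bounds.1]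
  have hR : ∀ θ ∈ Icc a a', ∀ s ∈ Icc ((b.sA : ℚ) : ℝ) ((b.smax : ℚ) : ℝ), Xa - ((b.smax : ℚ) : ℝ) ≤ Xa + s * Real.cos θ ∧ Xa + s * Real.cos θ ≤ Xa + ((b.smax : ℚ) : ℝ) := by
    intro θ _ s hs
    have hc1 := Real.neg_one_le_cos θ; have hc2 := Real.cos_le_one θ
    have hs0 : 0 ≤ s := hsA0.le.trans hs.1
    have h1 := mul_le_mul_of_nonneg_left hc1 hs0
    have h2 := mul_le_mul_of_nonneg_left hc2 hs0
    constructor <;> linarith [hs.2]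
  -- ray radius: in the tube, on the surface, continuous, positive slope
  have hρ : ∀ θ ∈ Icc a a', rayProfile U Xa 0 θ (ρ θ) = u₀ ∧ |ρ θ - mθ θ| < ((ℓ.r : ℚ) : ℝ) ∧ 0 < ρ θ ∧ ρ θ < 1 ∧ 0 < Dfield θ (ρ θ) := by
    intro θ hθ
    obtain ⟨hI, hval, -⟩ := rayRadius_spec (ψ := U) (Rc := Xa) (Zc := 0) (u := u₀) (θ := θ) hsA0 hsAsmax'
      (hin θ hθ) (hcontF θ) (hmono θ hθ) (hout θ hθ)
    obtain ⟨h1, h2⟩ := hθm θ hθ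
    have htube := rayRadius_mem_Ioo_of_signs hF hsA0 hsAsmax' hin hmono hout hθ (show ((b.sA : ℚ) : ℝ) ≤ mθ θ - ((ℓ.r : ℚ) : ℝ) by linarith)
      (show mθ θ - ((ℓ.r : ℚ) : ℝ) ≤ mθ θ + ((ℓ.r : ℚ) : ℝ) by linarith) (show mθ θ + ((ℓ.r : ℚ) : ℝ) ≤ ((b.smax : ℚ) : ℝ) by linarith) (hsign θ hθ).1 (hsign θ hθ).2
    refine ⟨hval, ?_, hsA0.trans hI.1, hI.2.trans hsmax1, hlam0.trans_le (hDstrip θ hθ _ ⟨hI.1.le, hI.2.le⟩).1⟩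
    have ht1 := htube.1; have ht2 := htube.2
    show |rayRadius U Xa 0 u₀ θ - mθ θ| < ((ℓ.r : ℚ) : ℝ)
    rw [abs_lt]; constructor <;> linarith only [ht1, ht2]
  have hρcont : ContinuousOn ρ (Icc a a') := continuousOn_rayRadius hF hsA0 hsAsmax' hin hmono hout
  -- the approximant's integrand Φm and its certified integral
  set Φm : ℝ → ℝ := fun θ => polarKernel Xa Dfield θ (mθ θ) with hΦm
  have hgA : ∀ t : ℝ, progG.toFunP params t = Φm (Real.pi * t) * Real.pi := by
    intro t
    rw [progG_toFunP]
    simp only [hΦm, polarKernel, mθ, DrA, Dfield, mul_div_cancel_left₀ t hpi.ne']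
    rw [div_eq_mul_inv]
  obtain ⟨hseg1, hseg2, hsegI⟩ := hseg
  have hev1 : ∀ t : ℝ, Poly.eval [1] t = 1 := by intro t; simp [Poly.eval_cons, Poly.eval_nil]
  simp only [hev1, mul_one] at hseg1 hseg2 hsegI
  -- ∫_{t₀}^{t₁} gA = ∫_a^{a'} Φm
  have hJ : ∫ t in ((panelLeft hw d.j : ℚ) : ℝ)..((panelLeft hw (d.j + 1) : ℚ) : ℝ), progG.toFunP params t
      = ∫ θ in a..a', Φm θ := by
    simp_rw [hgA]
    rw [intervalIntegral.integral_mul_const, mul_comm, ← smul_eq_mul, intervalIntegral.smul_integral_comp_mul_left]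
  have hJlo : (d.plo : ℝ) / ((tmS : ℕ) : ℝ) ≤ ∫ θ in a..a', Φm θ := by
    rw [← hJ, div_le_iff₀ hS, mul_comm]; exact hseg1
  have hJhi : ∫ θ in a..a', Φm θ ≤ (d.phi : ℝ) / ((tmS : ℕ) : ℝ) := by
    rw [← hJ, le_div_iff₀ hS, mul_comm]; exact hseg2
  -- integrability of Φm on [a, a']
  have hmid : IntervalIntegrable Φm volume a a' := by
    have h1 : IntervalIntegrable (fun x => progG.toFunP params (Real.pi⁻¹ * x)) volume
        (((panelLeft hw d.j : ℚ) : ℝ) / Real.pi⁻¹) (((panelLeft hw (d.j + 1) : ℚ) : ℝ) / Real.pi⁻¹) :=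
      hsegI.comp_mul_left (h := enorm_ne_top) (h' := enorm_ne_top)
    have e1 : ((panelLeft hw d.j : ℚ) : ℝ) / Real.pi⁻¹ = a := by rw [div_inv_eq_mul, mul_comm]
    have e2 : ((panelLeft hw (d.j + 1) : ℚ) : ℝ) / Real.pi⁻¹ = a' := by rw [div_inv_eq_mul, mul_comm]
    rw [e1, e2] at h1
    have h2 := h1.div_const Real.pi
    have hfun : (fun x => progG.toFunP params (Real.pi⁻¹ * x) / Real.pi) = Φm := by
      funext x
      rw [hgA, mul_inv_cancel_left₀ hpi.ne' x, mul_div_cancel_right₀ _ hpi.ne']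
    rw [hfun] at h2
    exact h2
  -- the relative envelope on the tube
  have crX' : ((ℓ.r : ℚ) : ℝ) < (((XaLoQ : ℚ) : ℝ) - ((b.smax : ℚ) : ℝ)) := by
    have := (show ((ℓ.r : ℚ) : ℝ) < ((XaLoQ - b.smax : ℚ) : ℝ) by exact_mod_cast crX); push_cast at this; exact this
  have hXlo0 : 0 < (((XaLoQ : ℚ) : ℝ) - ((b.smax : ℚ) : ℝ)) := hr0.trans crX'
  have crD' : ((b.M : ℚ) : ℝ) * ((ℓ.r : ℚ) : ℝ) < ((d.dlo : ℝ) / ((tmS : ℕ) : ℝ)) := by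
    have := (show ((b.M * ℓ.r : ℚ) : ℝ) < ((((d.dlo : ℚ) / tmS : ℚ)) : ℝ) by exact_mod_cast crD); push_cast at this; exact this
  have ceps' : ((ℓ.r : ℚ) : ℝ) / ((d.mlo : ℝ) / ((tmS : ℕ) : ℝ)) + ((ℓ.r : ℚ) : ℝ) / (((XaLoQ : ℚ) : ℝ) - ((b.smax : ℚ) : ℝ)) + ((b.M : ℚ) : ℝ) * ((ℓ.r : ℚ) : ℝ) / ((d.dlo : ℝ) / ((tmS : ℕ) : ℝ)) ≤ ((ℓ.eps : ℚ) : ℝ) := by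
    have := (show ((ℓ.r / ((d.mlo : ℚ) / tmS) + ℓ.r / (XaLoQ - b.smax) + b.M * ℓ.r / ((d.dlo : ℚ) / tmS) : ℚ) : ℝ)
      ≤ ((ℓ.eps : ℚ) : ℝ) by exact_mod_cast ceps); push_cast at this; exact this
  have ceps1' : ((ℓ.eps : ℚ) : ℝ) ≤ 1 := by exact_mod_cast ceps1
  have ckplus' : 1 + ((ℓ.r : ℚ) : ℝ) / ((d.mlo : ℝ) / ((tmS : ℕ) : ℝ)) ≤ ((ℓ.kplus : ℚ) : ℝ) * (1 - ((ℓ.r : ℚ) : ℝ) / (((XaLoQ : ℚ) : ℝ) - ((b.smax : ℚ) : ℝ))) * (1 - ((b.M : ℚ) : ℝ) * ((ℓ.r : ℚ) : ℝ) / ((d.dlo : ℝ) / ((tmS : ℕ) : ℝ))) := by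
    have := (show ((1 + ℓ.r / ((d.mlo : ℚ) / tmS) : ℚ) : ℝ)
      ≤ ((ℓ.kplus * (1 - ℓ.r / (XaLoQ - b.smax)) * (1 - b.M * ℓ.r / ((d.dlo : ℚ) / tmS)) : ℚ) : ℝ) by exact_mod_cast ckplus)
    push_cast at this; exact this
  have hrmlo : ((ℓ.r : ℚ) : ℝ) < ((d.mlo : ℝ) / ((tmS : ℕ) : ℝ)) := by linarith [hsAr, hsA0]
  have henv : ∀ θ ∈ Icc a a', ∀ s ∈ Icc (mθ θ - ((ℓ.r : ℚ) : ℝ)) (mθ θ + ((ℓ.r : ℚ) : ℝ)),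
      (1 - ((ℓ.eps : ℚ) : ℝ)) * Φm θ ≤ polarKernel Xa Dfield θ s ∧ polarKernel Xa Dfield θ s ≤ ((ℓ.kplus : ℚ) : ℝ) * Φm θ := by
    intro θ hθ s hs
    have hs' := htube_sub θ hθ s hs
    obtain ⟨h1, h2⟩ := hθm θ hθ
    obtain ⟨hD1, -⟩ := hθD θ hθ
    have habs : |s - mθ θ| ≤ ((ℓ.r : ℚ) : ℝ) := abs_le.2 ⟨by linarith [hs.1], by linarith [hs.2]⟩
    have hX : |(Xa + s * Real.cos θ) - (Xa + mθ θ * Real.cos θ)| ≤ ((ℓ.r : ℚ) : ℝ) := by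
      rw [show (Xa + s * Real.cos θ) - (Xa + mθ θ * Real.cos θ) = (s - mθ θ) * Real.cos θ by ring, abs_mul]
      exact le_trans (mul_le_of_le_one_right (abs_nonneg _) (Real.abs_cos_le_one θ)) habs
    have hDs : |Dfield θ s - Dfield θ (mθ θ)| ≤ ((b.M : ℚ) : ℝ) * ((ℓ.r : ℚ) : ℝ) :=
      le_trans (hLip θ hθ s hs' (mθ θ) (hmstrip θ hθ)) (mul_le_mul_of_nonneg_left habs hM0)
    have hXm : (((XaLoQ : ℚ) : ℝ) - ((b.smax : ℚ) : ℝ)) ≤ Xa + mθ θ * Real.cos θ := by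
      have hc := Real.neg_one_le_cos θ
      have hmpos : 0 ≤ mθ θ := hmlo0.le.trans h1
      have h3 := mul_le_mul_of_nonneg_left hc hmpos
      linarith [hXaLo, hmhir, hr0]
    exact envelope hr0 hmlo0 hXlo0 hdlo0 hM0 h1 hXm hD1 habs hX hDs hrmlo crX' crD' ceps' ceps1' ckplus'
  -- the glue: envelope of the true integrand on the tube ⇒ panel integral bracket
  have hℓ₁₂ : ∀ θ ∈ Icc a a', ((b.sA : ℚ) : ℝ) ≤ mθ θ - ((ℓ.r : ℚ) : ℝ) ∧ mθ θ - ((ℓ.r : ℚ) : ℝ) ≤ mθ θ + ((ℓ.r : ℚ) : ℝ) ∧ mθ θ + ((ℓ.r : ℚ) : ℝ) ≤ ((b.smax : ℚ) : ℝ) := by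
    intro θ hθ; obtain ⟨h1, h2⟩ := hθm θ hθ; exact ⟨by linarith, by linarith, by linarith⟩
  have hE := panel_integral_envelope (ψ := U) (Rc := Xa) (Zc := 0) (u := u₀) (D := Dfield)
    (ℓ₁ := fun θ => mθ θ - ((ℓ.r : ℚ) : ℝ)) (ℓ₂ := fun θ => mθ θ + ((ℓ.r : ℚ) : ℝ)) (glo := fun θ => (1 - ((ℓ.eps : ℚ) : ℝ)) * Φm θ) (ghi := fun θ => ((ℓ.kplus : ℚ) : ℝ) * Φm θ)
    hF hDc haa' hsA0 hsAsmax' hin hmono hout hlam0 hDstrip hRlo hR hℓ₁₂ hsign henv (hmid.const_mul _) (hmid.const_mul _)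
  obtain ⟨hElo, hEhi⟩ := hE
  rw [intervalIntegral.integral_const_mul] at hElo hEhi
  have hint : IntervalIntegrable (polarIntegrand U Xa 0 u₀ Dfield) volume a a' :=
    ((continuousOn_polarIntegrand hF hDc hsA0 hsAsmax' hin hmono hout hlam0 hDstrip hRlo hR).mono
      (by rw [uIcc_of_le haa'])).intervalIntegrable
  refine ⟨?_, ?_, hint, hρcont, fun θ hθ => hρ θ hθ⟩
  · have h1 : ((ℓ.Lo : ℚ) : ℝ) ≤ (1 - ((ℓ.eps : ℚ) : ℝ)) * ((d.plo : ℝ) / ((tmS : ℕ) : ℝ)) := by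
      have := (show ((ℓ.Lo : ℚ) : ℝ) ≤ (((1 - ℓ.eps) * ((d.plo : ℚ) / tmS) : ℚ) : ℝ) by exact_mod_cast cLo)
      push_cast at this; exact this
    have h2 : (1 - ((ℓ.eps : ℚ) : ℝ)) * ((d.plo : ℝ) / ((tmS : ℕ) : ℝ)) ≤ (1 - ((ℓ.eps : ℚ) : ℝ)) * ∫ θ in a..a', Φm θ :=
      mul_le_mul_of_nonneg_left hJlo (by linarith)
    linarith
  · have hb1 : 0 < 1 - ((ℓ.r : ℚ) : ℝ) / (((XaLoQ : ℚ) : ℝ) - ((b.smax : ℚ) : ℝ)) := by rw [sub_pos, div_lt_one hXlo0]; exact crX'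
    have hc1 : 0 < 1 - ((b.M : ℚ) : ℝ) * ((ℓ.r : ℚ) : ℝ) / ((d.dlo : ℝ) / ((tmS : ℕ) : ℝ)) := by rw [sub_pos, div_lt_one hdlo0]; exact crD'
    have hkp0 : 0 ≤ ((ℓ.kplus : ℚ) : ℝ) := by
      have hpos : 0 < 1 + ((ℓ.r : ℚ) : ℝ) / ((d.mlo : ℝ) / ((tmS : ℕ) : ℝ)) := by positivity
      by_contra hneg
      push Not at hneg
      have : ((ℓ.kplus : ℚ) : ℝ) * (1 - ((ℓ.r : ℚ) : ℝ) / (((XaLoQ : ℚ) : ℝ) - ((b.smax : ℚ) : ℝ))) * (1 - ((b.M : ℚ) : ℝ) * ((ℓ.r : ℚ) : ℝ) / ((d.dlo : ℝ) / ((tmS : ℕ) : ℝ))) ≤ 0 := by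
        have := mul_pos hb1 hc1
        nlinarith
      linarith
    have h1 : ((ℓ.kplus : ℚ) : ℝ) * ∫ θ in a..a', Φm θ ≤ ((ℓ.kplus : ℚ) : ℝ) * ((d.phi : ℝ) / ((tmS : ℕ) : ℝ)) := mul_le_mul_of_nonneg_left hJhi hkp0
    have h2 : ((ℓ.kplus : ℚ) : ℝ) * ((d.phi : ℝ) / ((tmS : ℕ) : ℝ)) ≤ ((ℓ.Hi : ℚ) : ℝ) := by
      have := (show ((ℓ.kplus * ((d.phi : ℚ) / tmS) : ℚ) : ℝ) ≤ ((ℓ.Hi : ℚ) : ℝ) by exact_mod_cast cHi)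
      push_cast at this; exact this
    linarith

end panel

end Summit.Ventures.FusionMHD.Models.CFIterLike.QHalf

end
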